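import Summits.FinalStateConjecture.FinalStateConjecture.Theorems.ClusterCompletenessRecurrentlyFlatDispersesStubSettlesOfScriCapture

/-!
# Crux `RecurrentlyFlatDisperses` (stmt-FinalStateConjecture-14665), line `Sketch` — THESES-FREE GLUE for the open core

Continuation lead c2, 2026-08-16. Companion of `ClusterCompletenessRecurrentlyFlatDispersesReduction.lean` (p122425), whose three
glue theorems conclude the route decl `Theses.ClusterCompleteness.RecurrentlyFlatDisperses` BY NAME and therefore import the
route's Theses file. That makes them certificates only: neither the crux's eventual closer nor a planner's glue elaborated
INSIDE `Theses/ClusterCompleteness.lean` (glued split of the crux, D-0019) may import a module that imports that Theses file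
(the gate appends `<Decl>_holds` to the Theses file importing the closer — an import cycle otherwise). This file restates the
same three glue theorems with the crux BODY VERBATIM as conclusion and imports only the (Theses-free, p122522) packaging brick
`stub_settlesOfScriCapture`, so that

* a planner can write, inside the Theses file, `theorem … : Child₁ → Child₂ → RecurrentlyFlatDisperses :=
  Theorems.RecurrentlyFlatDisperses.crux_of_scri_of_dispersal` (the defs δ-unfold to the bodies below), and
* a closer `theorem RecurrentlyFlatDisperses_proof : <body> := crux_of_… h₁ h₂` stays Theses-free.

The three shapes (see the companion file for the discussion):
* `crux_of_oneSlabScriCapture` — ONE-SLAB SCRI-CAPTURE at some order (`OneSlabScriCapture` of the skeleton) ⇒ crux;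
* `crux_of_scri_of_dispersal` — SCRI half and DISPERSAL half under the crux's own recurrence hypothesis, orders maxed ⇒ crux;
* `crux_of_oneSlabScri_of_oneSlabDispersal` — the one-slab halves, thresholds `min`ed ⇒ crux.

Statement-cone vocabulary only (unfolded, no `def`), Mathlib + the Statement + one Theorems brick; no named facts.
-/

noncomputable section

open scoped Manifold ContDiff Topology
open Filter Set TopologicalSpace Literature.Geometry.Lorentzian

namespace Summit.FinalStateConjecture.FinalStateConjecture.Theorems.RecurrentlyFlatDisperses

/-- **Theses-free glue (line `Sketch`, Transfer): one-slab scri-capture at some order implies the crux (body verbatim).** If for some `k` every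
admissible datum has a threshold `ε₀ > 0` such that, in every maximal vacuum Cauchy development, an anchored flat late chart
of the crux's shape (late chart on the whole half-space `{x⁰ > τ₀}`, `O = exteriorOf` of its image, uncharted part of `O`
causally below every slab, `C⁰` deviation `≤ 1/4` on every late slab) carrying ONE late slab that is `ε₀`-flat in `Cᵏ` forces
complete `𝓘⁺` (sojourn form) and a convergent (`C²`) exhaustive anchored flat late chart, then
`Theses.ClusterCompleteness.RecurrentlyFlatDisperses` holds (with the same `k`: recurrence for `ε₀` supplies a deep slab beyond
`τ₀ + 1`, and the landed packaging `stub_settlesOfScriCapture` gives the Statement's conclusion). -/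
theorem crux_of_oneSlabScriCapture :
    (∃ k : ℕ, ∀ (X : Type) [TopologicalSpace X] [ChartedSpace E3 X] [IsManifold (𝓡 3) ∞ X]
      [T2Space X] [SecondCountableTopology X] [ConnectedSpace X],
      ∀ D ∈ admissibleVacuumData X, ∃ ε₀ : ℝ, 0 < ε₀ ∧
        ∀ 𝒟 : VacuumCauchyDevelopment D, 𝒟.IsMaximal →
        ∀ (O : Set 𝒟.carrier) (τ₀ : ℝ) (U₀ : Opens E4) (Ψ₀ : U₀ → 𝒟.carrier),
          (𝒟.toSpacetime.IsLateChart (Minkowski.backgroundOn U₀) O τ₀ Ψ₀ ∧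
            {x : E4 | τ₀ < x 0} ⊆ (U₀ : Set E4) ∧
            O = Summit.FinalStateConjecture.exteriorOf 𝒟.toCauchyDevelopment
              (Ψ₀ '' (Minkowski.backgroundOn U₀).lateRegion τ₀) ∧
            (∀ τ₁ : ℝ, τ₀ < τ₁ → O \ Ψ₀ '' (Minkowski.backgroundOn U₀).lateRegion τ₁ ⊆
              𝒟.metric.causalPast 𝒟.timeOrientation
                (Ψ₀ '' (Minkowski.backgroundOn U₀).timeSlab τ₁)) ∧
            (∀ τ : ℝ, τ₀ < τ → 𝒟.toSpacetime.deviationCk (Minkowski.backgroundOn U₀) Ψ₀ 0 τ ≤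
              ENNReal.ofReal (1 / 4))) →
          (∃ τ : ℝ, τ₀ < τ ∧
            𝒟.toSpacetime.deviationCk (Minkowski.backgroundOn U₀) Ψ₀ k τ ≤ ENNReal.ofReal ε₀) →
          (Summit.FinalStateConjecture.HasCompleteNullInfinity 𝒟.toCauchyDevelopment ∧
          ∃ (τ₁ : ℝ) (U₁ : Opens E4) (Φ : U₁ → 𝒟.carrier),
            {x : E4 | τ₁ < x 0} ⊆ (U₁ : Set E4) ∧
            𝒟.toSpacetime.IsLateChart (Minkowski.backgroundOn U₁)
              (Summit.FinalStateConjecture.exteriorOf 𝒟.toCauchyDevelopment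
                (Φ '' (Minkowski.backgroundOn U₁).lateRegion τ₁)) τ₁ Φ ∧
            Tendsto (fun τ ↦ 𝒟.toSpacetime.deviationCk (Minkowski.backgroundOn U₁) Φ 2 τ)
              atTop (𝓝 0) ∧
            (∀ τ : ℝ, τ₁ ≤ τ →
              Summit.FinalStateConjecture.exteriorOf 𝒟.toCauchyDevelopment
                  (Φ '' (Minkowski.backgroundOn U₁).lateRegion τ₁) \
                    Φ '' (Minkowski.backgroundOn U₁).lateRegion τ ⊆
                𝒟.metric.causalPast 𝒟.timeOrientation
                  (Φ '' (Minkowski.backgroundOn U₁).timeSlab τ)))) →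
    (∃ k : ℕ, ∀ (X : Type) [TopologicalSpace X] [ChartedSpace E3 X] [IsManifold (𝓡 3) ∞ X] [T2Space X]
      [SecondCountableTopology X] [ConnectedSpace X],
      ∀ D ∈ admissibleVacuumData X, ∀ 𝒟 : VacuumCauchyDevelopment D, 𝒟.IsMaximal →
        (∃ (O : Set 𝒟.carrier) (τ₀ : ℝ) (U₀ : Opens E4) (Ψ₀ : U₀ → 𝒟.carrier),
          𝒟.toSpacetime.IsLateChart (Minkowski.backgroundOn U₀) O τ₀ Ψ₀ ∧
            {x : E4 | τ₀ < x 0} ⊆ (U₀ : Set E4) ∧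
            O = Summit.FinalStateConjecture.exteriorOf 𝒟.toCauchyDevelopment
              (Ψ₀ '' (Minkowski.backgroundOn U₀).lateRegion τ₀) ∧
            (∀ τ₁ : ℝ, τ₀ < τ₁ → O \ Ψ₀ '' (Minkowski.backgroundOn U₀).lateRegion τ₁ ⊆
              𝒟.metric.causalPast 𝒟.timeOrientation
                (Ψ₀ '' (Minkowski.backgroundOn U₀).timeSlab τ₁)) ∧
            (∀ τ : ℝ, τ₀ < τ → 𝒟.toSpacetime.deviationCk (Minkowski.backgroundOn U₀) Ψ₀ 0 τ ≤
              ENNReal.ofReal (1 / 4)) ∧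
            ∀ ε : ℝ, 0 < ε → ∃ᶠ τ in atTop,
              𝒟.toSpacetime.deviationCk (Minkowski.backgroundOn U₀) Ψ₀ k τ ≤ ENNReal.ofReal ε) →
        (Summit.FinalStateConjecture.HasCompleteNullInfinity 𝒟.toCauchyDevelopment ∧
          ∃ (O : Set 𝒟.carrier) (d : FinalStateDecomposition 𝒟.toSpacetime O 2),
            (∀ i, Kerr.IsSubextremal (d.mass i) (d.spin i)) ∧
              O = Summit.FinalStateConjecture.exteriorOf 𝒟.toCauchyDevelopment d.charted ∧
                Summit.FinalStateConjecture.HasExhaustiveCharts d)) := by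
  rintro ⟨k, hk⟩
  refine ⟨k, ?_⟩
  intro X _ _ _ _ _ _ D hD 𝒟 hmax hex
  obtain ⟨O, τ₀, U₀, Ψ₀, hlate, hU, hO, hexh, hanc, hrec⟩ := hex
  obtain ⟨ε₀, hε₀, hcap⟩ := hk X D hD
  obtain ⟨τ, hτ, hdev⟩ := (hrec ε₀ hε₀).forall_exists_of_atTop (τ₀ + 1)
  exact stub_settlesOfScriCapture X D 𝒟
    (hcap 𝒟 hmax O τ₀ U₀ Ψ₀ ⟨hlate, hU, hO, hexh, hanc⟩ ⟨τ, by linarith, hdev⟩)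

/-- **Theses-free glue (weakest split, by conclusion, under full recurrence): SCRI half and DISPERSAL half imply the crux (body verbatim).**
If for some `k_A` every anchored flat late chart of the crux's shape on which `Cᵏᴬ`-flatness recurs for every `ε > 0`
forces complete `𝓘⁺` of the development (sojourn form), and for some `k_B` every such chart on which `Cᵏᴮ`-flatness recurs
forces a convergent (`C²`) exhaustive anchored flat late chart, then `Theses.ClusterCompleteness.RecurrentlyFlatDisperses`
holds at order `max k_A k_B` (recurrence at the larger order implies recurrence at each smaller one by
`Spacetime.deviationCk_mono`; packaging by the landed `stub_settlesOfScriCapture`). -/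
theorem crux_of_scri_of_dispersal :
    (∃ k : ℕ, ∀ (X : Type) [TopologicalSpace X] [ChartedSpace E3 X] [IsManifold (𝓡 3) ∞ X]
      [T2Space X] [SecondCountableTopology X] [ConnectedSpace X],
      ∀ D ∈ admissibleVacuumData X, ∀ 𝒟 : VacuumCauchyDevelopment D, 𝒟.IsMaximal →
        ∀ (O : Set 𝒟.carrier) (τ₀ : ℝ) (U₀ : Opens E4) (Ψ₀ : U₀ → 𝒟.carrier),
          (𝒟.toSpacetime.IsLateChart (Minkowski.backgroundOn U₀) O τ₀ Ψ₀ ∧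
            {x : E4 | τ₀ < x 0} ⊆ (U₀ : Set E4) ∧
            O = Summit.FinalStateConjecture.exteriorOf 𝒟.toCauchyDevelopment
              (Ψ₀ '' (Minkowski.backgroundOn U₀).lateRegion τ₀) ∧
            (∀ τ₁ : ℝ, τ₀ < τ₁ → O \ Ψ₀ '' (Minkowski.backgroundOn U₀).lateRegion τ₁ ⊆
              𝒟.metric.causalPast 𝒟.timeOrientation
                (Ψ₀ '' (Minkowski.backgroundOn U₀).timeSlab τ₁)) ∧
            (∀ τ : ℝ, τ₀ < τ → 𝒟.toSpacetime.deviationCk (Minkowski.backgroundOn U₀) Ψ₀ 0 τ ≤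
              ENNReal.ofReal (1 / 4))) →
          (∀ ε : ℝ, 0 < ε → ∃ᶠ τ in atTop,
            𝒟.toSpacetime.deviationCk (Minkowski.backgroundOn U₀) Ψ₀ k τ ≤ ENNReal.ofReal ε) →
          Summit.FinalStateConjecture.HasCompleteNullInfinity 𝒟.toCauchyDevelopment) →
    (∃ k : ℕ, ∀ (X : Type) [TopologicalSpace X] [ChartedSpace E3 X] [IsManifold (𝓡 3) ∞ X]
      [T2Space X] [SecondCountableTopology X] [ConnectedSpace X],
      ∀ D ∈ admissibleVacuumData X, ∀ 𝒟 : VacuumCauchyDevelopment D, 𝒟.IsMaximal →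
        ∀ (O : Set 𝒟.carrier) (τ₀ : ℝ) (U₀ : Opens E4) (Ψ₀ : U₀ → 𝒟.carrier),
          (𝒟.toSpacetime.IsLateChart (Minkowski.backgroundOn U₀) O τ₀ Ψ₀ ∧
            {x : E4 | τ₀ < x 0} ⊆ (U₀ : Set E4) ∧
            O = Summit.FinalStateConjecture.exteriorOf 𝒟.toCauchyDevelopment
              (Ψ₀ '' (Minkowski.backgroundOn U₀).lateRegion τ₀) ∧
            (∀ τ₁ : ℝ, τ₀ < τ₁ → O \ Ψ₀ '' (Minkowski.backgroundOn U₀).lateRegion τ₁ ⊆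
              𝒟.metric.causalPast 𝒟.timeOrientation
                (Ψ₀ '' (Minkowski.backgroundOn U₀).timeSlab τ₁)) ∧
            (∀ τ : ℝ, τ₀ < τ → 𝒟.toSpacetime.deviationCk (Minkowski.backgroundOn U₀) Ψ₀ 0 τ ≤
              ENNReal.ofReal (1 / 4))) →
          (∀ ε : ℝ, 0 < ε → ∃ᶠ τ in atTop,
            𝒟.toSpacetime.deviationCk (Minkowski.backgroundOn U₀) Ψ₀ k τ ≤ ENNReal.ofReal ε) →
          ∃ (τ₁ : ℝ) (U₁ : Opens E4) (Φ : U₁ → 𝒟.carrier),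
            {x : E4 | τ₁ < x 0} ⊆ (U₁ : Set E4) ∧
            𝒟.toSpacetime.IsLateChart (Minkowski.backgroundOn U₁)
              (Summit.FinalStateConjecture.exteriorOf 𝒟.toCauchyDevelopment
                (Φ '' (Minkowski.backgroundOn U₁).lateRegion τ₁)) τ₁ Φ ∧
            Tendsto (fun τ ↦ 𝒟.toSpacetime.deviationCk (Minkowski.backgroundOn U₁) Φ 2 τ)
              atTop (𝓝 0) ∧
            (∀ τ : ℝ, τ₁ ≤ τ →
              Summit.FinalStateConjecture.exteriorOf 𝒟.toCauchyDevelopment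
                  (Φ '' (Minkowski.backgroundOn U₁).lateRegion τ₁) \
                    Φ '' (Minkowski.backgroundOn U₁).lateRegion τ ⊆
                𝒟.metric.causalPast 𝒟.timeOrientation
                  (Φ '' (Minkowski.backgroundOn U₁).timeSlab τ))) →
    (∃ k : ℕ, ∀ (X : Type) [TopologicalSpace X] [ChartedSpace E3 X] [IsManifold (𝓡 3) ∞ X] [T2Space X]
      [SecondCountableTopology X] [ConnectedSpace X],
      ∀ D ∈ admissibleVacuumData X, ∀ 𝒟 : VacuumCauchyDevelopment D, 𝒟.IsMaximal →
        (∃ (O : Set 𝒟.carrier) (τ₀ : ℝ) (U₀ : Opens E4) (Ψ₀ : U₀ → 𝒟.carrier),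
          𝒟.toSpacetime.IsLateChart (Minkowski.backgroundOn U₀) O τ₀ Ψ₀ ∧
            {x : E4 | τ₀ < x 0} ⊆ (U₀ : Set E4) ∧
            O = Summit.FinalStateConjecture.exteriorOf 𝒟.toCauchyDevelopment
              (Ψ₀ '' (Minkowski.backgroundOn U₀).lateRegion τ₀) ∧
            (∀ τ₁ : ℝ, τ₀ < τ₁ → O \ Ψ₀ '' (Minkowski.backgroundOn U₀).lateRegion τ₁ ⊆
              𝒟.metric.causalPast 𝒟.timeOrientation
                (Ψ₀ '' (Minkowski.backgroundOn U₀).timeSlab τ₁)) ∧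
            (∀ τ : ℝ, τ₀ < τ → 𝒟.toSpacetime.deviationCk (Minkowski.backgroundOn U₀) Ψ₀ 0 τ ≤
              ENNReal.ofReal (1 / 4)) ∧
            ∀ ε : ℝ, 0 < ε → ∃ᶠ τ in atTop,
              𝒟.toSpacetime.deviationCk (Minkowski.backgroundOn U₀) Ψ₀ k τ ≤ ENNReal.ofReal ε) →
        (Summit.FinalStateConjecture.HasCompleteNullInfinity 𝒟.toCauchyDevelopment ∧
          ∃ (O : Set 𝒟.carrier) (d : FinalStateDecomposition 𝒟.toSpacetime O 2),
            (∀ i, Kerr.IsSubextremal (d.mass i) (d.spin i)) ∧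
              O = Summit.FinalStateConjecture.exteriorOf 𝒟.toCauchyDevelopment d.charted ∧
                Summit.FinalStateConjecture.HasExhaustiveCharts d)) := by
  rintro ⟨kA, hkA⟩ ⟨kB, hkB⟩
  refine ⟨max kA kB, ?_⟩
  intro X _ _ _ _ _ _ D hD 𝒟 hmax hex
  obtain ⟨O, τ₀, U₀, Ψ₀, hlate, hU, hO, hexh, hanc, hrec⟩ := hex
  have hrecA : ∀ ε : ℝ, 0 < ε → ∃ᶠ τ in atTop,
      𝒟.toSpacetime.deviationCk (Minkowski.backgroundOn U₀) Ψ₀ kA τ ≤ ENNReal.ofReal ε :=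
    fun ε hε ↦ (hrec ε hε).mono fun τ hτ ↦
      (𝒟.toSpacetime.deviationCk_mono (Minkowski.backgroundOn U₀) Ψ₀ (le_max_left kA kB) τ).trans hτ
  have hrecB : ∀ ε : ℝ, 0 < ε → ∃ᶠ τ in atTop,
      𝒟.toSpacetime.deviationCk (Minkowski.backgroundOn U₀) Ψ₀ kB τ ≤ ENNReal.ofReal ε :=
    fun ε hε ↦ (hrec ε hε).mono fun τ hτ ↦
      (𝒟.toSpacetime.deviationCk_mono (Minkowski.backgroundOn U₀) Ψ₀ (le_max_right kA kB) τ).trans hτ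
  exact stub_settlesOfScriCapture X D 𝒟
    ⟨hkA X D hD 𝒟 hmax O τ₀ U₀ Ψ₀ ⟨hlate, hU, hO, hexh, hanc⟩ hrecA,
      hkB X D hD 𝒟 hmax O τ₀ U₀ Ψ₀ ⟨hlate, hU, hO, hexh, hanc⟩ hrecB⟩

/-- **Theses-free glue (one-slab split, by conclusion): one-slab SCRI half and one-slab DISPERSAL half imply the crux (body verbatim).** If for some
`k_A` every admissible datum has `ε_A > 0` such that an anchored flat late chart of the crux's shape with one late slab
`ε_A`-flat in `Cᵏᴬ` forces complete `𝓘⁺`, and for some `k_B` a threshold `ε_B > 0` such that one late slab `ε_B`-flat in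
`Cᵏᴮ` forces a convergent exhaustive flat late chart, then `Theses.ClusterCompleteness.RecurrentlyFlatDisperses` holds at order
`max k_A k_B`: recurrence for `min ε_A ε_B` supplies one deep slab serving both halves (`Spacetime.deviationCk_mono`). -/
theorem crux_of_oneSlabScri_of_oneSlabDispersal :
    (∃ k : ℕ, ∀ (X : Type) [TopologicalSpace X] [ChartedSpace E3 X] [IsManifold (𝓡 3) ∞ X]
      [T2Space X] [SecondCountableTopology X] [ConnectedSpace X],
      ∀ D ∈ admissibleVacuumData X, ∃ ε₀ : ℝ, 0 < ε₀ ∧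
        ∀ 𝒟 : VacuumCauchyDevelopment D, 𝒟.IsMaximal →
        ∀ (O : Set 𝒟.carrier) (τ₀ : ℝ) (U₀ : Opens E4) (Ψ₀ : U₀ → 𝒟.carrier),
          (𝒟.toSpacetime.IsLateChart (Minkowski.backgroundOn U₀) O τ₀ Ψ₀ ∧
            {x : E4 | τ₀ < x 0} ⊆ (U₀ : Set E4) ∧
            O = Summit.FinalStateConjecture.exteriorOf 𝒟.toCauchyDevelopment
              (Ψ₀ '' (Minkowski.backgroundOn U₀).lateRegion τ₀) ∧
            (∀ τ₁ : ℝ, τ₀ < τ₁ → O \ Ψ₀ '' (Minkowski.backgroundOn U₀).lateRegion τ₁ ⊆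
              𝒟.metric.causalPast 𝒟.timeOrientation
                (Ψ₀ '' (Minkowski.backgroundOn U₀).timeSlab τ₁)) ∧
            (∀ τ : ℝ, τ₀ < τ → 𝒟.toSpacetime.deviationCk (Minkowski.backgroundOn U₀) Ψ₀ 0 τ ≤
              ENNReal.ofReal (1 / 4))) →
          (∃ τ : ℝ, τ₀ < τ ∧
            𝒟.toSpacetime.deviationCk (Minkowski.backgroundOn U₀) Ψ₀ k τ ≤ ENNReal.ofReal ε₀) →
          Summit.FinalStateConjecture.HasCompleteNullInfinity 𝒟.toCauchyDevelopment) →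
    (∃ k : ℕ, ∀ (X : Type) [TopologicalSpace X] [ChartedSpace E3 X] [IsManifold (𝓡 3) ∞ X]
      [T2Space X] [SecondCountableTopology X] [ConnectedSpace X],
      ∀ D ∈ admissibleVacuumData X, ∃ ε₀ : ℝ, 0 < ε₀ ∧
        ∀ 𝒟 : VacuumCauchyDevelopment D, 𝒟.IsMaximal →
        ∀ (O : Set 𝒟.carrier) (τ₀ : ℝ) (U₀ : Opens E4) (Ψ₀ : U₀ → 𝒟.carrier),
          (𝒟.toSpacetime.IsLateChart (Minkowski.backgroundOn U₀) O τ₀ Ψ₀ ∧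
            {x : E4 | τ₀ < x 0} ⊆ (U₀ : Set E4) ∧
            O = Summit.FinalStateConjecture.exteriorOf 𝒟.toCauchyDevelopment
              (Ψ₀ '' (Minkowski.backgroundOn U₀).lateRegion τ₀) ∧
            (∀ τ₁ : ℝ, τ₀ < τ₁ → O \ Ψ₀ '' (Minkowski.backgroundOn U₀).lateRegion τ₁ ⊆
              𝒟.metric.causalPast 𝒟.timeOrientation
                (Ψ₀ '' (Minkowski.backgroundOn U₀).timeSlab τ₁)) ∧
            (∀ τ : ℝ, τ₀ < τ → 𝒟.toSpacetime.deviationCk (Minkowski.backgroundOn U₀) Ψ₀ 0 τ ≤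
              ENNReal.ofReal (1 / 4))) →
          (∃ τ : ℝ, τ₀ < τ ∧
            𝒟.toSpacetime.deviationCk (Minkowski.backgroundOn U₀) Ψ₀ k τ ≤ ENNReal.ofReal ε₀) →
          ∃ (τ₁ : ℝ) (U₁ : Opens E4) (Φ : U₁ → 𝒟.carrier),
            {x : E4 | τ₁ < x 0} ⊆ (U₁ : Set E4) ∧
            𝒟.toSpacetime.IsLateChart (Minkowski.backgroundOn U₁)
              (Summit.FinalStateConjecture.exteriorOf 𝒟.toCauchyDevelopment
                (Φ '' (Minkowski.backgroundOn U₁).lateRegion τ₁)) τ₁ Φ ∧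
            Tendsto (fun τ ↦ 𝒟.toSpacetime.deviationCk (Minkowski.backgroundOn U₁) Φ 2 τ)
              atTop (𝓝 0) ∧
            (∀ τ : ℝ, τ₁ ≤ τ →
              Summit.FinalStateConjecture.exteriorOf 𝒟.toCauchyDevelopment
                  (Φ '' (Minkowski.backgroundOn U₁).lateRegion τ₁) \
                    Φ '' (Minkowski.backgroundOn U₁).lateRegion τ ⊆
                𝒟.metric.causalPast 𝒟.timeOrientation
                  (Φ '' (Minkowski.backgroundOn U₁).timeSlab τ))) →
    (∃ k : ℕ, ∀ (X : Type) [TopologicalSpace X] [ChartedSpace E3 X] [IsManifold (𝓡 3) ∞ X] [T2Space X]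
      [SecondCountableTopology X] [ConnectedSpace X],
      ∀ D ∈ admissibleVacuumData X, ∀ 𝒟 : VacuumCauchyDevelopment D, 𝒟.IsMaximal →
        (∃ (O : Set 𝒟.carrier) (τ₀ : ℝ) (U₀ : Opens E4) (Ψ₀ : U₀ → 𝒟.carrier),
          𝒟.toSpacetime.IsLateChart (Minkowski.backgroundOn U₀) O τ₀ Ψ₀ ∧
            {x : E4 | τ₀ < x 0} ⊆ (U₀ : Set E4) ∧
            O = Summit.FinalStateConjecture.exteriorOf 𝒟.toCauchyDevelopment
              (Ψ₀ '' (Minkowski.backgroundOn U₀).lateRegion τ₀) ∧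
            (∀ τ₁ : ℝ, τ₀ < τ₁ → O \ Ψ₀ '' (Minkowski.backgroundOn U₀).lateRegion τ₁ ⊆
              𝒟.metric.causalPast 𝒟.timeOrientation
                (Ψ₀ '' (Minkowski.backgroundOn U₀).timeSlab τ₁)) ∧
            (∀ τ : ℝ, τ₀ < τ → 𝒟.toSpacetime.deviationCk (Minkowski.backgroundOn U₀) Ψ₀ 0 τ ≤
              ENNReal.ofReal (1 / 4)) ∧
            ∀ ε : ℝ, 0 < ε → ∃ᶠ τ in atTop,
              𝒟.toSpacetime.deviationCk (Minkowski.backgroundOn U₀) Ψ₀ k τ ≤ ENNReal.ofReal ε) →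
        (Summit.FinalStateConjecture.HasCompleteNullInfinity 𝒟.toCauchyDevelopment ∧
          ∃ (O : Set 𝒟.carrier) (d : FinalStateDecomposition 𝒟.toSpacetime O 2),
            (∀ i, Kerr.IsSubextremal (d.mass i) (d.spin i)) ∧
              O = Summit.FinalStateConjecture.exteriorOf 𝒟.toCauchyDevelopment d.charted ∧
                Summit.FinalStateConjecture.HasExhaustiveCharts d)) := by
  rintro ⟨kA, hkA⟩ ⟨kB, hkB⟩
  refine ⟨max kA kB, ?_⟩
  intro X _ _ _ _ _ _ D hD 𝒟 hmax hex
  obtain ⟨O, τ₀, U₀, Ψ₀, hlate, hU, hO, hexh, hanc, hrec⟩ := hex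
  obtain ⟨εA, hεA, hcapA⟩ := hkA X D hD
  obtain ⟨εB, hεB, hcapB⟩ := hkB X D hD
  obtain ⟨τ, hτ, hdev⟩ := (hrec (min εA εB) (lt_min hεA hεB)).forall_exists_of_atTop (τ₀ + 1)
  have hτ₀ : τ₀ < τ := by linarith
  have hdevA : 𝒟.toSpacetime.deviationCk (Minkowski.backgroundOn U₀) Ψ₀ kA τ ≤ ENNReal.ofReal εA :=
    ((𝒟.toSpacetime.deviationCk_mono (Minkowski.backgroundOn U₀) Ψ₀ (le_max_left kA kB) τ).trans
      hdev).trans (ENNReal.ofReal_le_ofReal (min_le_left εA εB))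
  have hdevB : 𝒟.toSpacetime.deviationCk (Minkowski.backgroundOn U₀) Ψ₀ kB τ ≤ ENNReal.ofReal εB :=
    ((𝒟.toSpacetime.deviationCk_mono (Minkowski.backgroundOn U₀) Ψ₀ (le_max_right kA kB) τ).trans
      hdev).trans (ENNReal.ofReal_le_ofReal (min_le_right εA εB))
  exact stub_settlesOfScriCapture X D 𝒟
    ⟨hcapA 𝒟 hmax O τ₀ U₀ Ψ₀ ⟨hlate, hU, hO, hexh, hanc⟩ ⟨τ, hτ₀, hdevA⟩,
      hcapB 𝒟 hmax O τ₀ U₀ Ψ₀ ⟨hlate, hU, hO, hexh, hanc⟩ ⟨τ, hτ₀, hdevB⟩⟩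

end Summit.FinalStateConjecture.FinalStateConjecture.Theorems.RecurrentlyFlatDisperses

end
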